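import Mathlib
import Literature.Computability.Complexity.OccurrenceObstructionsBIP
import Literature.Computability.AlgebraicComplexity.ApolarityAction

/-!
# The four-row pencil method ends at `√2·n`: the tangent rank is at most `4(n² + 1)`

Wall-breaker axis P-explicit for crux `ValuativeGCT.ValuativeFlip` (stmt-ValiantsHypothesis-12624), line
`four-row-count`.  The head machinery of the line (`headCensus_at`, `headFlipBody_of_pencilCert_at`,
`fourRow_census_of_rank`) turns a base point `g ∈ GL_{m²}` whose FOUR-ROW TANGENT SPAN

  `span{ X_a · (∂_b (g · X₀₀^{m-n} per_n))|_{four kept variables} : a kept, b ∈ MatIdx m }`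

has dimension `≥ 2m² + m + 2` into the flip body at `(n, m)`; the companion file `…HeadSqrtTwo`
supplies such `g` for every `n ≥ 10`, `n ≤ m`, `(m + 13)² ≤ 2n²`.  This file is the matching ceiling:

* `card_keptSlots_le` — at most four row slots are kept;
* `fourRowTangentRank_le` — for EVERY `g` the four-row tangent span has dimension `≤ 4(n² + 1)`: by the
  chain rule `∂_b (g·p) = Σ_c g_{bc} · g·(∂_c p)` (`pderiv_linSubst_eq_sum`) only the `≤ n² + 1` variables
  of the padded permanent (`vars_paddedPerFormLex_subset`) contribute derivative directions;
* `fourRow_rankHyp_unsat` — hence for `m² ≥ 2n² + 2` (all `m ≥ √2·n + 1`) the rank hypothesis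
  `2m² + m + 2 ≤ dim` of the head machinery holds for NO base point.

So the four-row pencil method covers exactly the positions `m < √2·n` up to an additive constant
(reached: `√2·n - 13`; impossible: `√2·n + 1`), the per-side form of the strategist's dimension count
(per side `4n² - 2n + 5` four-variable dimensions).  Elementary; no named facts. [this crux; new]
-/

set_option linter.dupNamespace false

namespace Summit.ValiantsHypothesis.ValiantsHypothesis.Theorems.ValuativeFlip

open MvPolynomial Module
open scoped BigOperators Matrix
open Literature.NumberTheory.DiophantineGeometry
open Literature.Computability.AlgebraicComplexity
open Literature.Computability.Complexity

noncomputable section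

/-- **At most four row slots are kept**: the slots `a` with `m² ≤ idx(a) + 4` inject into `Fin 4` by
`a ↦ m² - 1 - idx(a)`. [folklore] -/
theorem card_keptSlots_le (m : ℕ) :
    Fintype.card {a : MatIdx m // m * m ≤ (((matIdxEquiv m).symm a : Fin (m * m)) : ℕ) + 4} ≤ 4 := by
  classical
  let f : {a : MatIdx m // m * m ≤ (((matIdxEquiv m).symm a : Fin (m * m)) : ℕ) + 4} → Fin 4 :=
    fun a => ⟨m * m - 1 - (((matIdxEquiv m).symm a.1 : Fin (m * m)) : ℕ), by
      have h1 := a.2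
      have h2 := ((matIdxEquiv m).symm a.1).isLt
      omega⟩
  have hf : Function.Injective f := by
    rintro ⟨a, ha⟩ ⟨b, hb⟩ h
    simp only [f, Fin.mk.injEq] at h
    have hia := ((matIdxEquiv m).symm a).isLt
    have hib := ((matIdxEquiv m).symm b).isLt
    have hidx : (((matIdxEquiv m).symm a : Fin (m * m)) : ℕ) =
        (((matIdxEquiv m).symm b : Fin (m * m)) : ℕ) := by omega
    have hab : a = b := (matIdxEquiv m).symm.injective (Fin.ext hidx)
    subst hab
    rfl
  simpa using Fintype.card_le_of_injective f hf

/-- **The four-row tangent span has dimension at most `4(n² + 1)`**, for every base point `g` and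
every `n ≤ m`: each generator `X_a · (∂_b (g·pp))|₄` is a combination of the `≤ 4·(n² + 1)`
elements `X_a · (g·(∂_c pp))|₄`, `a` kept, `c` a variable of `pp = X₀₀^{m-n} per_n`. [this crux; new] -/
theorem fourRowTangentRank_le (n m : ℕ) [NeZero m] (hnm : n ≤ m) (g : GL (MatIdx m) ℂ) :
    Module.finrank ℂ ↥(Submodule.span ℂ (Set.range fun ab : {a : MatIdx m // m * m ≤ (((matIdxEquiv m).symm a : Fin (m * m)) : ℕ) + 4} × MatIdx m => (MvPolynomial.X ab.1.1 : MvPolynomial (MatIdx m) ℂ) * MvPolynomial.aeval (fun i : MatIdx m => if m * m ≤ (((matIdxEquiv m).symm i : Fin (m * m)) : ℕ) + 4 then (MvPolynomial.X i : MvPolynomial (MatIdx m) ℂ) else 0) (MvPolynomial.pderiv ab.2 (linSubst (MatIdx m) ℂ ((g : GL (MatIdx m) ℂ) : Matrix (MatIdx m) (MatIdx m) ℂ) (paddedPerFormLex ℂ n m))))) ≤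
      4 * (n ^ 2 + 1) := by
  classical
  set pp := paddedPerFormLex ℂ n m with hpp
  set A : Matrix (MatIdx m) (MatIdx m) ℂ := ((g : GL (MatIdx m) ℂ) : Matrix (MatIdx m) (MatIdx m) ℂ)
    with hA
  set keep : MatIdx m → MvPolynomial (MatIdx m) ℂ := fun i : MatIdx m =>
    if m * m ≤ (((matIdxEquiv m).symm i : Fin (m * m)) : ℕ) + 4 then (MvPolynomial.X i : MvPolynomial (MatIdx m) ℂ)
    else 0 with hkeep
  set S : Finset (MatIdx m) := insert (toLex ((0 : Fin m), (0 : Fin m)) : MatIdx m)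
    (Finset.univ.image fun ij : BlockIdx n m × BlockIdx n m =>
      (toLex ((ij.1 : Fin m), (ij.2 : Fin m)) : MatIdx m)) with hSdef
  have hvars : (↑pp.vars : Set (MatIdx m)) ⊆ (↑S : Set (MatIdx m)) := vars_paddedPerFormLex_subset n m
  have hS : S.card ≤ n ^ 2 + 1 := card_insert_image_blockIdx_le n m hnm
  -- the smaller family, indexed by kept slots × variables of `pp`
  let G : {a : MatIdx m // m * m ≤ (((matIdxEquiv m).symm a : Fin (m * m)) : ℕ) + 4} × ↥S →
      MvPolynomial (MatIdx m) ℂ :=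
    fun ac => X ac.1.1 * aeval keep (linSubst (MatIdx m) ℂ A (pderiv ac.2.1 pp))
  haveI : Module.Finite ℂ ↥(Submodule.span ℂ (Set.range G)) :=
    FiniteDimensional.span_of_finite ℂ (Set.finite_range _)
  have hle : Submodule.span ℂ (Set.range fun ab : {a : MatIdx m // m * m ≤ (((matIdxEquiv m).symm a : Fin (m * m)) : ℕ) + 4} × MatIdx m =>
        (MvPolynomial.X ab.1.1 : MvPolynomial (MatIdx m) ℂ) * MvPolynomial.aeval keep
          (MvPolynomial.pderiv ab.2 (linSubst (MatIdx m) ℂ A pp))) ≤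
      Submodule.span ℂ (Set.range G) := by
    rw [Submodule.span_le]
    rintro _ ⟨⟨a, b⟩, rfl⟩
    change X a.1 * aeval keep (pderiv b (linSubst (MatIdx m) ℂ A pp)) ∈ Submodule.span ℂ (Set.range G)
    rw [pderiv_linSubst_eq_sum, map_sum, Finset.mul_sum]
    refine Submodule.sum_mem _ fun c _ => ?_
    by_cases hc : c ∈ S
    · rw [map_smul, mul_smul_comm]
      exact Submodule.smul_mem _ _ (Submodule.subset_span ⟨(a, ⟨c, hc⟩), rfl⟩)
    · have h0 : pderiv c pp = 0 :=
        pderiv_eq_zero_of_notMem_vars fun h => hc (Finset.mem_coe.mp (hvars (Finset.mem_coe.mpr h)))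
      rw [h0, map_zero, smul_zero, map_zero, mul_zero]
      exact Submodule.zero_mem _
  calc Module.finrank ℂ ↥(Submodule.span ℂ (Set.range fun ab : {a : MatIdx m // m * m ≤ (((matIdxEquiv m).symm a : Fin (m * m)) : ℕ) + 4} × MatIdx m =>
          (MvPolynomial.X ab.1.1 : MvPolynomial (MatIdx m) ℂ) * MvPolynomial.aeval keep
            (MvPolynomial.pderiv ab.2 (linSubst (MatIdx m) ℂ A pp))))
        ≤ Module.finrank ℂ ↥(Submodule.span ℂ (Set.range G)) := Submodule.finrank_mono hle
    _ ≤ Fintype.card ({a : MatIdx m // m * m ≤ (((matIdxEquiv m).symm a : Fin (m * m)) : ℕ) + 4} × ↥S) :=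
        finrank_range_le_card G
    _ = Fintype.card {a : MatIdx m // m * m ≤ (((matIdxEquiv m).symm a : Fin (m * m)) : ℕ) + 4} * S.card := by
        rw [Fintype.card_prod, Fintype.card_coe]
    _ ≤ 4 * (n ^ 2 + 1) := Nat.mul_le_mul (card_keptSlots_le m) hS

/-- **The four-row method ends at `√2·n + 1`**: for `n ≤ m` with `m² ≥ 2n² + 2` the rank hypothesis
`2m² + m + 2 ≤ dim(four-row tangent span of g·pp)` of the head machinery (`headCensus_at`,
`fourRow_census_of_rank`) fails for EVERY base point `g`. [this crux; new] -/
theorem fourRow_rankHyp_unsat (n m : ℕ) [NeZero m] (hnm : n ≤ m) (hm : 2 * n ^ 2 + 2 ≤ m ^ 2)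
    (g : GL (MatIdx m) ℂ) :
    Module.finrank ℂ ↥(Submodule.span ℂ (Set.range fun ab : {a : MatIdx m // m * m ≤ (((matIdxEquiv m).symm a : Fin (m * m)) : ℕ) + 4} × MatIdx m => (MvPolynomial.X ab.1.1 : MvPolynomial (MatIdx m) ℂ) * MvPolynomial.aeval (fun i : MatIdx m => if m * m ≤ (((matIdxEquiv m).symm i : Fin (m * m)) : ℕ) + 4 then (MvPolynomial.X i : MvPolynomial (MatIdx m) ℂ) else 0) (MvPolynomial.pderiv ab.2 (linSubst (MatIdx m) ℂ ((g : GL (MatIdx m) ℂ) : Matrix (MatIdx m) (MatIdx m) ℂ) (paddedPerFormLex ℂ n m))))) <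
      2 * m ^ 2 + m + 2 :=
  lt_of_le_of_lt (fourRowTangentRank_le n m hnm g) (by nlinarith)

end

end Summit.ValiantsHypothesis.ValiantsHypothesis.Theorems.ValuativeFlip
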